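import Summits.AtomisticToContinuum.Crystallization.Theorems.ChartedPlanarOrderPlanesIdentity

/-!
# Slot 7b by the method of planes, module P3f: window bookkeeping (decomp-a2c lens-3 g26; critic row 523 (b))

Pure finite-sum lemmas on an integer window `[K₀, K₁]`, no geometry (companion of `…PlanesIdentity`):
* `sum_sum_mul_symm` — SYMMETRISATION: for a symmetric pair function `g` with zero diagonal and layer weights `N`,
  `Σ_{k,l ∈ [K₀,K₁]} N_k g(k,l) = Σ_{K₀ ≤ k < l ≤ K₁} (N_k + N_l) g(k,l)`;
* `sum_Ioc_sub` — telescoping `Σ_{m ∈ (k,l]} (z_m − z_{m−1}) = z_l − z_k`;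
* `sum_sum_ite_span_le` — at most `s₀²` pairs `k < m ≤ l` of span `l − k ≤ s₀` straddle a given gap `m`;
* `sum_sum_Ico_le` — exchanging a sum over gaps `m` with a sum over the `2 s₀` neighbouring gaps `j ∈ [m − s₀, m + s₀)`:
  `Σ_{m ∈ (K₀,K₁]} Σ_{j ∈ [m−s₀, m+s₀)} g j ≤ 2 s₀ Σ_{j ∈ [K₀−s₀, K₁+s₀)} g j` for `g ≥ 0`.

Mathlib only; `[folklore]`; no instances, no notation, sorry-free.
-/

namespace Summit.AtomisticToContinuum.Crystallization.Theorems.ChartedPlanarOrderPlanesWindow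

open Finset
open Summit.AtomisticToContinuum.Crystallization.Theorems.ChartedPlanarOrderPlanesIdentity (sum_Ioc_eq_sum_Icc_ite)

/-- ★ SYMMETRISATION of a weighted double sum of a symmetric pair function with zero diagonal. -/
theorem sum_sum_mul_symm (K₀ K₁ : ℤ) (N : ℤ → ℝ) (g : ℤ → ℤ → ℝ) (hsymm : ∀ k l, g l k = g k l) (hdiag : ∀ k, g k k = 0) :
    ∑ k ∈ Icc K₀ K₁, ∑ l ∈ Icc K₀ K₁, N k * g k l = ∑ k ∈ Icc K₀ K₁, ∑ l ∈ Ioc k K₁, (N k + N l) * g k l := by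
  set I := Icc K₀ K₁ with hI
  have R1 : ∑ k ∈ I, ∑ l ∈ Ioc k K₁, (N k + N l) * g k l = ∑ k ∈ I, ∑ l ∈ I, if k < l then (N k + N l) * g k l else 0 := by
    refine sum_congr rfl fun k hk => ?_
    rw [hI, mem_Icc] at hk
    exact sum_Ioc_eq_sum_Icc_ite hk.1 _
  have A : ∑ k ∈ I, ∑ l ∈ I, (if k < l then (N k + N l) * g k l else 0) =
      ∑ k ∈ I, ∑ l ∈ I, (if k < l then N k * g k l else 0) + ∑ k ∈ I, ∑ l ∈ I, (if k < l then N l * g k l else 0) := by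
    rw [← sum_add_distrib]
    refine sum_congr rfl fun k _ => ?_
    rw [← sum_add_distrib]
    refine sum_congr rfl fun l _ => ?_
    split_ifs <;> ring
  have B : ∑ k ∈ I, ∑ l ∈ I, (if k < l then N l * g k l else 0) = ∑ k ∈ I, ∑ l ∈ I, (if l < k then N k * g k l else 0) := by
    rw [sum_comm]
    refine sum_congr rfl fun k _ => sum_congr rfl fun l _ => ?_
    rw [hsymm l k]
  rw [R1, A, B, ← sum_add_distrib]
  refine sum_congr rfl fun k _ => ?_
  rw [← sum_add_distrib]
  refine sum_congr rfl fun l _ => ?_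
  by_cases h1 : k < l
  · rw [if_pos h1, if_neg (not_lt.mpr h1.le), add_zero]
  · by_cases h2 : l < k
    · rw [if_neg h1, if_pos h2, zero_add]
    · have hkl : k = l := le_antisymm (not_lt.mp h2) (not_lt.mp h1)
      subst hkl
      simp [hdiag]

/-- telescoping over a gap interval: `Σ_{m ∈ (k, l]} (z m − z (m−1)) = z l − z k`. -/
theorem sum_Ioc_sub (z : ℤ → ℝ) {k l : ℤ} (hkl : k ≤ l) : ∑ m ∈ Ioc k l, (z m - z (m - 1)) = z l - z k := by
  obtain ⟨n, rfl⟩ : ∃ n : ℕ, l = k + n := ⟨(l - k).toNat, by rw [Int.toNat_of_nonneg (sub_nonneg.mpr hkl)]; ring⟩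
  clear hkl
  induction n with
  | zero => simp
  | succ n ih =>
    have hsplit : Ioc k (k + ((n + 1 : ℕ) : ℤ)) = insert (k + n + 1) (Ioc k (k + n)) := by
      ext m
      simp only [mem_Ioc, mem_insert, Nat.cast_succ]
      omega
    have hnot : (k + n + 1 : ℤ) ∉ Ioc k (k + n) := by simp
    rw [hsplit, sum_insert hnot, ih]
    push_cast
    ring_nf

/-- ★ pair counting: at most `s₀²` pairs `K₀ ≤ k < m ≤ l ≤ K₁` of span `l − k ≤ s₀` straddle the gap `m`. -/
theorem sum_sum_ite_span_le (K₀ K₁ m : ℤ) (s₀ : ℕ) {C : ℝ} (hC : 0 ≤ C) :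
    ∑ k ∈ Ico K₀ m, ∑ l ∈ Icc m K₁, (if l - k ≤ (s₀ : ℤ) then C else 0) ≤ (s₀ : ℝ) ^ 2 * C := by
  classical
  rw [← sum_product (s := Ico K₀ m) (t := Icc m K₁) (f := fun p : ℤ × ℤ => if p.2 - p.1 ≤ (s₀ : ℤ) then C else 0),
    ← sum_filter, sum_const, nsmul_eq_mul]
  refine mul_le_mul_of_nonneg_right ?_ hC
  have hsub : (Ico K₀ m ×ˢ Icc m K₁).filter (fun p : ℤ × ℤ => p.2 - p.1 ≤ (s₀ : ℤ)) ⊆ Ico (m - s₀) m ×ˢ Ico m (m + s₀) := by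
    intro p hp
    rw [mem_filter, mem_product, mem_Ico, mem_Icc] at hp
    rw [mem_product, mem_Ico, mem_Ico]
    omega
  have hcard := card_le_card hsub
  rw [card_product, Int.card_Ico, Int.card_Ico, show m - (m - (s₀ : ℤ)) = s₀ by ring,
    show m + (s₀ : ℤ) - m = s₀ by ring, Int.toNat_natCast] at hcard
  calc (((Ico K₀ m ×ˢ Icc m K₁).filter (fun p : ℤ × ℤ => p.2 - p.1 ≤ (s₀ : ℤ))).card : ℝ) ≤ ((s₀ * s₀ : ℕ) : ℝ) := by
        exact_mod_cast hcard
    _ = (s₀ : ℝ) ^ 2 := by push_cast; ring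

/-- ★ exchanging gaps with neighbouring gaps: each `j` lies in `[m − s₀, m + s₀)` for at most `2 s₀` gaps `m`. -/
theorem sum_sum_Ico_le (K₀ K₁ : ℤ) (s₀ : ℕ) (g : ℤ → ℝ) (hg : ∀ j, 0 ≤ g j) :
    ∑ m ∈ Ioc K₀ K₁, ∑ j ∈ Ico (m - s₀) (m + s₀), g j ≤ 2 * (s₀ : ℝ) * ∑ j ∈ Ico (K₀ - s₀) (K₁ + s₀), g j := by
  classical
  set J := Ico (K₀ - s₀) (K₁ + s₀) with hJ
  have h1 : ∀ m ∈ Ioc K₀ K₁, ∑ j ∈ Ico (m - s₀) (m + s₀), g j =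
      ∑ j ∈ J, if m - s₀ ≤ j ∧ j < m + s₀ then g j else 0 := by
    intro m hm
    rw [mem_Ioc] at hm
    rw [← sum_filter]
    congr 1
    ext j
    simp only [mem_Ico, mem_filter, hJ]
    omega
  rw [sum_congr rfl h1, sum_comm, mul_sum]
  refine sum_le_sum fun j _ => ?_
  rw [← sum_filter, sum_const, nsmul_eq_mul]
  have hsub : (Ioc K₀ K₁).filter (fun m => m - s₀ ≤ j ∧ j < m + s₀) ⊆ Ioc (j - s₀) (j + s₀) := by
    intro m hm
    rw [mem_filter, mem_Ioc] at hm
    rw [mem_Ioc]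
    omega
  have hcard := card_le_card hsub
  rw [Int.card_Ioc, show j + (s₀ : ℤ) - (j - s₀) = ((2 * s₀ : ℕ) : ℤ) by push_cast; ring, Int.toNat_natCast] at hcard
  have hc : (((Ioc K₀ K₁).filter (fun m => m - s₀ ≤ j ∧ j < m + s₀)).card : ℝ) ≤ 2 * (s₀ : ℝ) := by exact_mod_cast hcard
  exact mul_le_mul_of_nonneg_right hc (hg j)

end Summit.AtomisticToContinuum.Crystallization.Theorems.ChartedPlanarOrderPlanesWindow
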